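import Mathlib
import HarnessLib
import Summits.Ventures.LatticeQCDFlow.TrivializingMaps.GaugeCovariance
import Summits.Ventures.LatticeQCDFlow.TrivializingMaps.FlowPushforwardDensity
import Literature.MathematicalPhysics.QuantumFieldTheory.Luscher2010.TrivializingMaps

/-!
# Lüscher's coordinates on `𝔰𝔲(n)` and the trace of an operator compressed to `𝔰𝔲(n)`: the algebra behind Jacobi's formula for the `SU(N)` residual layer

HONEST FRAMING: exact (Metropolis-corrected) sampling algorithms for lattice gauge theory;
figures of merit are autocorrelation/cost numbers at stated couplings and volumes; no
continuum-physics claim.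

Venture `LatticeQCDFlow` (cell pub-lqcd), topic `Exactness`; FANOUT row 10 (`eng-equiv`: `equiv/residual.py`,
`flows_jax/residual_flow.py` — residual / stout / stout-defect layers and their closed-form per-link log-det).
NEW WORK of the cell; no definition (local notations only); nothing cited as a fact.  Series "the residual
layer's exact Jacobian IS the closed form" (8 files: `SUNJacobianTraceAlgebra`, `SUNResidualTangentDerivative`,
`SUNResidualTangentTimeDerivative`, `SUNResidualGeneratorDivergence`, `SUNResidualJacobiTrace`,
`SUNResidualJacobiIdentity`, `SUNResidualJacobiFlow`, `SUNResidualLayerJacobianDet`), continuing gen-11's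
`SUNResidualLayerVelocity` … `SUNResidualLayerJacobian` (existence of a continuous positive exact Jacobian).

File 1 of the series (imports nothing of it: fileable independently).  Elementary linear algebra on `M_n(ℂ)` as a real vector space, every `n`:
* `suBasis_coord_add/_smul/_zero/_sub/_sum`, `suBasis_coord_T` — Lüscher's coordinates `X^a = -2 Re tr(T^a X)`
  (`SuBasis.coord`) are `ℝ`-linear with `(T^b)^a = δ^{ab}`;
* **`suBasis_coord_suProj`** — `(𝒫 Y)^a = Y^a` for EVERY matrix `Y`; `suProj_eq_sum_coord_smul` — `𝒫 Y = ∑_b Y^b T^b`;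
* `suBasis_coord_commutator_self`, `sum_suBasis_coord_commutator` — `(A T^b − T^b A)^b = 0` (cyclicity);
* **`trace_suProj_comp_comp_suProj`** — `tr_{M_n(ℂ)}(𝒫 ∘ L ∘ 𝒫) = ∑_b (L T^b)^b` for every `ℝ`-linear `L`
  (`𝒫 = fderiv ℝ suProj 0`, Lüscher's projection as an operator; `fderiv_suProj_zero_apply`), hence **`trace_suProj_ad_suProj`** —
  `tr(𝒫 ∘ ad_A ∘ 𝒫) = 0` for every matrix `A`: the identity removing every commutator term from Jacobi's formula.

Printed counterparts, NAMED ONLY: Lüscher, CMP 293 (2010) 899, §3 eqs. (3.4)–(3.9); Abbott et al.,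
arXiv:2305.02402 §4.2; Morningstar–Peardon, PRD 69 (2004) 054501; Abel–Jacobi–Liouville (tree:
`Literature.Analysis.ODE.LiouvilleFormula`).
-/

noncomputable section

namespace Summit.Ventures.LatticeQCDFlow.Exactness

open Literature.MathematicalPhysics.QuantumFieldTheory
open Literature.MathematicalPhysics.QuantumFieldTheory.Luscher2010
open Literature.MathematicalPhysics.QuantumFieldTheory.WilsonFlow
open Summit.Ventures.LatticeQCDFlow.TrivializingMaps
open scoped Matrix Matrix.Norms.Frobenius

variable {n : ℕ}

/-! ## Lüscher's projection read as an operator at `0` -/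

/-- `fderiv ℝ 𝒫 0 = 𝒫` applied: the projection `suProj` is `ℝ`-linear (additive and `ℝ`-homogeneous by a
direct computation), so its Fréchet derivative at `0`, applied to `X`, is `suProj X`.  (This is the special
case at the base point `0` of `SUNResidualLayerVelocity.fderiv_suProj_apply`, re-derived here so that this
purely algebraic file does not depend on the residual-layer series.) -/
theorem fderiv_suProj_zero_apply (X : Matrix (Fin n) (Fin n) ℂ) :
    fderiv ℝ (suProj (n := n)) 0 X = suProj X := by
  have hadd : ∀ A B : Matrix (Fin n) (Fin n) ℂ, suProj (A + B) = suProj A + suProj B := by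
    intro A B
    ext i j
    simp only [suProj_def, Matrix.sub_apply, Matrix.add_apply, Matrix.smul_apply,
      Matrix.conjTranspose_apply, Matrix.trace_sub, Matrix.trace_add, Matrix.trace_conjTranspose,
      smul_eq_mul, star_add]
    ring
  have hsmul : ∀ (r : ℝ) (A : Matrix (Fin n) (Fin n) ℂ), suProj (r • A) = r • suProj A := by
    intro r A
    ext i j
    simp only [suProj_def, Matrix.sub_apply, Matrix.smul_apply, Matrix.conjTranspose_apply,
      Matrix.trace_sub, Matrix.trace_smul, Matrix.trace_conjTranspose, smul_eq_mul,
      Complex.real_smul, star_mul', Complex.star_def, Complex.conj_ofReal]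
    ring
  let Lc : Matrix (Fin n) (Fin n) ℂ →L[ℝ] Matrix (Fin n) (Fin n) ℂ := LinearMap.toContinuousLinearMap
    { toFun := suProj, map_add' := hadd, map_smul' := hsmul }
  have hL : HasFDerivAt (suProj (n := n)) Lc 0 := Lc.hasFDerivAt
  rw [hL.fderiv]
  rfl

/-! ## Lüscher's coordinates `X^a = -2 Re tr(T^a X)` are `ℝ`-linear and see only `𝒫 X` -/

/-- `coord` is additive. -/
theorem suBasis_coord_add (B : SuBasis n) (a : B.ι) (X Y : Matrix (Fin n) (Fin n) ℂ) :
    B.coord a (X + Y) = B.coord a X + B.coord a Y := by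
  unfold SuBasis.coord
  rw [Matrix.mul_add, Matrix.trace_add, Complex.add_re]
  ring

/-- `coord` is `ℝ`-homogeneous. -/
theorem suBasis_coord_smul (B : SuBasis n) (a : B.ι) (r : ℝ) (X : Matrix (Fin n) (Fin n) ℂ) :
    B.coord a (r • X) = r * B.coord a X := by
  unfold SuBasis.coord
  rw [Matrix.mul_smul, Matrix.trace_smul, Complex.smul_re, smul_eq_mul]
  ring

/-- `coord` vanishes at `0`. -/
theorem suBasis_coord_zero (B : SuBasis n) (a : B.ι) : B.coord a (0 : Matrix (Fin n) (Fin n) ℂ) = 0 := by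
  unfold SuBasis.coord
  rw [Matrix.mul_zero, Matrix.trace_zero, Complex.zero_re, mul_zero]

/-- `coord` of a difference. -/
theorem suBasis_coord_sub (B : SuBasis n) (a : B.ι) (X Y : Matrix (Fin n) (Fin n) ℂ) :
    B.coord a (X - Y) = B.coord a X - B.coord a Y := by
  rw [sub_eq_add_neg, suBasis_coord_add, suBasis_coord_neg, ← sub_eq_add_neg]

/-- `coord` commutes with finite sums. -/
theorem suBasis_coord_sum (B : SuBasis n) (a : B.ι) {ι' : Type*} (s : Finset ι')
    (X : ι' → Matrix (Fin n) (Fin n) ℂ) : B.coord a (∑ i ∈ s, X i) = ∑ i ∈ s, B.coord a (X i) := by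
  classical
  induction s using Finset.induction_on with
  | empty => rw [Finset.sum_empty, Finset.sum_empty, suBasis_coord_zero]
  | insert i s hi ih => rw [Finset.sum_insert hi, Finset.sum_insert hi, suBasis_coord_add, ih]

/-- Orthonormality in coordinates: `(T^b)^a = δ^{ab}`. -/
theorem suBasis_coord_T (B : SuBasis n) (a b : B.ι) : B.coord a (B.T b) = if a = b then 1 else 0 := by
  unfold SuBasis.coord
  rw [B.orth]
  split_ifs <;> norm_num

/-- **`coord` only sees the `𝔰𝔲(n)` part**: `(𝒫 Y)^a = Y^a` for every matrix `Y` (the Hermitian part and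
the scalar part of `Y` are `Re tr`-orthogonal to the anti-Hermitian traceless `T^a`). -/
theorem suBasis_coord_suProj (B : SuBasis n) (a : B.ι) (Y : Matrix (Fin n) (Fin n) ℂ) :
    B.coord a (suProj Y) = B.coord a Y := by
  obtain ⟨hT1, hT2⟩ := (mem_suAlgebra_iff _).1 (B.mem a)
  -- decomposition `Y = 𝒫 Y + (H + c • 1)` with `H` Hermitian
  set H : Matrix (Fin n) (Fin n) ℂ := (1 / 2 : ℂ) • (Y + Yᴴ) with hH
  set c : ℂ := (1 / (2 * n) : ℂ) * (Y - Yᴴ).trace with hc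
  have hdec : Y = suProj Y + (H + c • (1 : Matrix (Fin n) (Fin n) ℂ)) := by
    simp only [suProj, hH, hc, smul_sub, smul_add]
    module
  have hHh : Hᴴ = H := by
    have h2 : star (1 / 2 : ℂ) = 1 / 2 := by norm_num [Complex.ext_iff]
    rw [hH, Matrix.conjTranspose_smul, Matrix.conjTranspose_add, Matrix.conjTranspose_conjTranspose,
      add_comm, h2]
  -- `Re tr(T^a H) = 0`
  have hherm : (B.T a * H).trace.re = 0 := by
    have key : star (B.T a * H).trace = -(B.T a * H).trace := by
      rw [← Matrix.trace_conjTranspose, Matrix.conjTranspose_mul, hHh, hT1, Matrix.mul_neg,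
        Matrix.trace_neg, Matrix.trace_mul_comm]
    have h := congrArg Complex.re key
    rw [Complex.star_def, Complex.conj_re, Complex.neg_re] at h
    linarith
  -- `tr(T^a (c • 1)) = 0`
  have hscal : (B.T a * (c • (1 : Matrix (Fin n) (Fin n) ℂ))).trace = 0 := by
    rw [Matrix.mul_smul, Matrix.mul_one, Matrix.trace_smul, hT2, smul_zero]
  conv_rhs => rw [hdec]
  unfold SuBasis.coord
  rw [Matrix.mul_add, Matrix.mul_add, Matrix.trace_add, Matrix.trace_add, hscal, add_zero,
    Complex.add_re, hherm, add_zero]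

/-- Completeness read through `𝒫`: `𝒫 Y = ∑_b Y^b T^b` for EVERY matrix `Y`. -/
theorem suProj_eq_sum_coord_smul (B : SuBasis n) (Y : Matrix (Fin n) (Fin n) ℂ) :
    suProj Y = ∑ b, (B.coord b Y : ℝ) • B.T b := by
  have hmem : suProj Y ∈ suAlgebra n :=
    (mem_suAlgebra_iff _).2 ⟨conjTranspose_suProj Y, trace_suProj Y⟩
  conv_lhs => rw [← sum_coord_smul_eq B hmem]
  refine Finset.sum_congr rfl fun b _ => ?_
  rw [suBasis_coord_suProj, Complex.coe_smul]

/-- **Commutators have no diagonal**: `(A T^b − T^b A)^b = 0` for every matrix `A` and every `b`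
(cyclicity of the trace: `tr(T^b A T^b) = tr(T^b T^b A)`).  Hence `ad_A` compressed to `𝔰𝔲(n)` is
traceless — the fact that removes every commutator term from Jacobi's formula below. -/
theorem suBasis_coord_commutator_self (B : SuBasis n) (b : B.ι) (A : Matrix (Fin n) (Fin n) ℂ) :
    B.coord b (A * B.T b - B.T b * A) = 0 := by
  have h : (B.T b * (A * B.T b)).trace = (B.T b * (B.T b * A)).trace := by
    rw [Matrix.trace_mul_comm, Matrix.mul_assoc, Matrix.trace_mul_comm, Matrix.mul_assoc]
  unfold SuBasis.coord
  rw [Matrix.mul_sub, Matrix.trace_sub, h, sub_self, Complex.zero_re, mul_zero]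

/-- Summed form: `∑_b (A T^b − T^b A)^b = 0`. -/
theorem sum_suBasis_coord_commutator (B : SuBasis n) (A : Matrix (Fin n) (Fin n) ℂ) :
    ∑ b, B.coord b (A * B.T b - B.T b * A) = 0 :=
  Finset.sum_eq_zero fun b _ => suBasis_coord_commutator_self B b A

/-! ## The trace of an operator compressed to `𝔰𝔲(n)` -/

/-- **Trace formula.**  For every `ℝ`-linear operator `L` on `M_n(ℂ)` and every orthonormal basis
`(T^b)` of `𝔰𝔲(n)`: `tr_{M_n(ℂ)} (𝒫 ∘ L ∘ 𝒫) = ∑_b (L T^b)^b`, where `𝒫 = fderiv ℝ suProj 0` is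
Lüscher's projection read as an operator (`SUNResidualLayerVelocity.fderiv_suProj_apply`).  Proof:
`tr(𝒫 L 𝒫) = tr(L 𝒫)` and `𝒫 = ∑_b T^b ⊗ coord_b` is a sum of rank-one operators. -/
theorem trace_suProj_comp_comp_suProj (B : SuBasis n)
    (Lop : Matrix (Fin n) (Fin n) ℂ →L[ℝ] Matrix (Fin n) (Fin n) ℂ) :
    LinearMap.trace ℝ (Matrix (Fin n) (Fin n) ℂ)
        ((fderiv ℝ (suProj (n := n)) 0).comp (Lop.comp (fderiv ℝ (suProj (n := n)) 0)) :
          Matrix (Fin n) (Fin n) ℂ →ₗ[ℝ] Matrix (Fin n) (Fin n) ℂ) =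
      ∑ b, B.coord b (Lop (B.T b)) := by
  set P : Matrix (Fin n) (Fin n) ℂ →L[ℝ] Matrix (Fin n) (Fin n) ℂ := fderiv ℝ (suProj (n := n)) 0 with hP
  have hPapp : ∀ X, P X = suProj X := fun X => fderiv_suProj_zero_apply X
  -- the coordinate functionals
  let φ : B.ι → (Matrix (Fin n) (Fin n) ℂ →ₗ[ℝ] ℝ) := fun b =>
    { toFun := B.coord b
      map_add' := suBasis_coord_add B b
      map_smul' := fun r X => by rw [suBasis_coord_smul, RingHom.id_apply, smul_eq_mul] }
  have hφ : ∀ b X, φ b X = B.coord b X := fun b X => rfl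
  -- `𝒫` as a sum of rank-one operators
  have hPsum : (P : Matrix (Fin n) (Fin n) ℂ →ₗ[ℝ] Matrix (Fin n) (Fin n) ℂ) =
      ∑ b, (φ b).smulRight (B.T b) := by
    apply LinearMap.ext
    intro X
    rw [ContinuousLinearMap.coe_coe, hPapp, suProj_eq_sum_coord_smul B X, LinearMap.sum_apply]
    rfl
  -- `tr(𝒫 L 𝒫) = tr(L 𝒫 𝒫) = tr(L 𝒫)`
  have hPP : (P : Matrix (Fin n) (Fin n) ℂ →ₗ[ℝ] Matrix (Fin n) (Fin n) ℂ) *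
      (P : Matrix (Fin n) (Fin n) ℂ →ₗ[ℝ] Matrix (Fin n) (Fin n) ℂ) =
      (P : Matrix (Fin n) (Fin n) ℂ →ₗ[ℝ] Matrix (Fin n) (Fin n) ℂ) := by
    apply LinearMap.ext
    intro X
    change P (P X) = P X
    rw [hPapp, hPapp, suProj_suProj]
  have hcycl : LinearMap.trace ℝ _ ((P.comp (Lop.comp P) : Matrix (Fin n) (Fin n) ℂ →L[ℝ] _) :
        Matrix (Fin n) (Fin n) ℂ →ₗ[ℝ] Matrix (Fin n) (Fin n) ℂ) =
      LinearMap.trace ℝ _ ((Lop : Matrix (Fin n) (Fin n) ℂ →ₗ[ℝ] Matrix (Fin n) (Fin n) ℂ) ∘ₗ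
        (P : Matrix (Fin n) (Fin n) ℂ →ₗ[ℝ] Matrix (Fin n) (Fin n) ℂ)) := by
    have h1 : ((P.comp (Lop.comp P) : Matrix (Fin n) (Fin n) ℂ →L[ℝ] _) :
        Matrix (Fin n) (Fin n) ℂ →ₗ[ℝ] Matrix (Fin n) (Fin n) ℂ) =
        (P : Matrix (Fin n) (Fin n) ℂ →ₗ[ℝ] Matrix (Fin n) (Fin n) ℂ) *
          ((Lop : Matrix (Fin n) (Fin n) ℂ →ₗ[ℝ] Matrix (Fin n) (Fin n) ℂ) *
            (P : Matrix (Fin n) (Fin n) ℂ →ₗ[ℝ] Matrix (Fin n) (Fin n) ℂ)) := rfl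
    rw [h1, LinearMap.trace_mul_comm, mul_assoc, hPP]
    rfl
  have hcomp : (Lop : Matrix (Fin n) (Fin n) ℂ →ₗ[ℝ] _) ∘ₗ (∑ b, (φ b).smulRight (B.T b)) =
      ∑ b, (φ b).smulRight (Lop (B.T b)) := by
    apply LinearMap.ext
    intro X
    rw [LinearMap.comp_apply, LinearMap.sum_apply, LinearMap.sum_apply, ContinuousLinearMap.coe_coe,
      map_sum]
    refine Finset.sum_congr rfl fun b _ => ?_
    rw [LinearMap.smulRight_apply, LinearMap.smulRight_apply, ContinuousLinearMap.map_smul]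
  rw [hcycl, hPsum, hcomp, map_sum]
  refine Finset.sum_congr rfl fun b _ => ?_
  have hdual : (φ b).smulRight (Lop (B.T b)) =
      dualTensorHom ℝ (Matrix (Fin n) (Fin n) ℂ) (Matrix (Fin n) (Fin n) ℂ) (φ b ⊗ₜ Lop (B.T b)) := by
    apply LinearMap.ext
    intro X
    rw [LinearMap.smulRight_apply, dualTensorHom_apply]
  rw [hdual, LinearMap.trace_eq_contract_apply, contractLeft_apply, hφ]

/-- **`ad` compressed to `𝔰𝔲(n)` is traceless**: for every matrix `A`,
`tr(𝒫 ∘ ad_A ∘ 𝒫) = ∑_b (A T^b − T^b A)^b = 0`, with `ad_A = fderiv ℝ (Y ↦ A Y − Y A) 0`. -/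
theorem trace_suProj_ad_suProj (B : SuBasis n) (A : Matrix (Fin n) (Fin n) ℂ) :
    LinearMap.trace ℝ (Matrix (Fin n) (Fin n) ℂ)
        ((fderiv ℝ (suProj (n := n)) 0).comp
          ((fderiv ℝ (fun Y : Matrix (Fin n) (Fin n) ℂ => A * Y - Y * A) 0).comp
            (fderiv ℝ (suProj (n := n)) 0)) :
          Matrix (Fin n) (Fin n) ℂ →ₗ[ℝ] Matrix (Fin n) (Fin n) ℂ) = 0 := by
  rw [trace_suProj_comp_comp_suProj B]
  have had : ∀ Y, fderiv ℝ (fun Y : Matrix (Fin n) (Fin n) ℂ => A * Y - Y * A) 0 Y = A * Y - Y * A := by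
    intro Y
    have hd : HasFDerivAt (fun Y : Matrix (Fin n) (Fin n) ℂ => A * Y - Y * A)
        (((ContinuousLinearMap.mul ℝ (Matrix (Fin n) (Fin n) ℂ)) A) -
          ((ContinuousLinearMap.mul ℝ (Matrix (Fin n) (Fin n) ℂ)).flip A)) 0 :=
      ((ContinuousLinearMap.mul ℝ (Matrix (Fin n) (Fin n) ℂ)) A).hasFDerivAt.sub
        ((ContinuousLinearMap.mul ℝ (Matrix (Fin n) (Fin n) ℂ)).flip A).hasFDerivAt
    have h2 : fderiv ℝ (fun Y : Matrix (Fin n) (Fin n) ℂ => A * Y - Y * A) 0 =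
        ((ContinuousLinearMap.mul ℝ (Matrix (Fin n) (Fin n) ℂ)) A) -
          ((ContinuousLinearMap.mul ℝ (Matrix (Fin n) (Fin n) ℂ)).flip A) := hd.fderiv
    rw [h2]
    rfl
  simp_rw [had]
  exact sum_suBasis_coord_commutator B A

end Summit.Ventures.LatticeQCDFlow.Exactness

end

/-! ## The determinant of a block operator `𝒫 ∘ L ∘ 𝒫 + (1 − 𝒫)` is the determinant of its `𝔰𝔲(n)` coordinate matrix (GEN-13 append)

Pure linear algebra continuing the first part (uses `fderiv_suProj_zero_apply`, `suBasis_coord_*`,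
`suProj_eq_sum_coord_smul`): **`det_suProj_block_eq_matrix_det`**.  The tangential operators `Top[τ, W, a]` of the
residual-layer series are literally `𝒫 ∘ Blk[τ, W, a] ∘ 𝒫 + (1 − 𝒫)`, so the closed form `∏_a det Top[1, U, a]`
(`SUNResidualLayerJacobianDet`) IS the product of the determinants of the real `(n²−1)×(n²−1)` coordinate matrices
the engine assembles.  Printed counterparts, NAMED ONLY: Lüscher, CMP 293 (2010) 899, App. A; Abbott et al. 2305.02402 §4.2. -/

noncomputable section

namespace Summit.Ventures.LatticeQCDFlow.Exactness

open Literature.MathematicalPhysics.QuantumFieldTheory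
open Literature.MathematicalPhysics.QuantumFieldTheory.Luscher2010
open Literature.MathematicalPhysics.QuantumFieldTheory.WilsonFlow
open Summit.Ventures.LatticeQCDFlow.TrivializingMaps
open scoped Matrix Matrix.Norms.Frobenius

variable {n : ℕ}

/-- **`det (𝒫 ∘ L ∘ 𝒫 + (1 − 𝒫)) = det ((L T^c)^b)_{bc}`.**  For every `ℝ`-linear operator `L` on `M_n(ℂ)` and
every orthonormal basis `(T^b)` of `𝔰𝔲(n)` (`SuBasis`), the block operator `𝒫 ∘ L ∘ 𝒫 + (1 − 𝒫)`
(`𝒫 = fderiv ℝ suProj 0`, Lüscher's projection as an operator) — which is how the tangential operators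
`Top[τ, W, a]` of the residual-layer series are built from their blocks `Blk[τ, W, a]` — has determinant equal
to the determinant of the `(n² − 1) × (n² − 1)` real matrix of coordinates `(L T^c)^b = -2 Re tr(T^b · L T^c)`.
(The operator is `(𝒫 L|_{𝔰𝔲(n)}) ⊕ 1` on `M_n(ℂ) = 𝔰𝔲(n) ⊕ ker 𝒫` — the dictionary between the Lean closed
form `∏_a det Top[1, U, a]` and the engine's booked log-det.) -/
theorem det_suProj_block_eq_matrix_det (B : SuBasis n)
    (Lop : Matrix (Fin n) (Fin n) ℂ →L[ℝ] Matrix (Fin n) (Fin n) ℂ) :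
    ((fderiv ℝ (suProj (n := n)) 0).comp (Lop.comp (fderiv ℝ (suProj (n := n)) 0)) +
        (ContinuousLinearMap.id ℝ (Matrix (Fin n) (Fin n) ℂ) - fderiv ℝ (suProj (n := n)) 0)).det =
      (Matrix.of fun b c : B.ι => B.coord b (Lop (B.T c))).det := by
  classical
  set P : Matrix (Fin n) (Fin n) ℂ →L[ℝ] Matrix (Fin n) (Fin n) ℂ := fderiv ℝ (suProj (n := n)) 0 with hP
  have hPapp : ∀ X, P X = suProj X := fun X => fderiv_suProj_zero_apply X
  set p : Matrix (Fin n) (Fin n) ℂ →ₗ[ℝ] Matrix (Fin n) (Fin n) ℂ :=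
    (P : Matrix (Fin n) (Fin n) ℂ →ₗ[ℝ] Matrix (Fin n) (Fin n) ℂ) with hp
  have hpapp : ∀ X, p X = suProj X := fun X => hPapp X
  have hidem : IsIdempotentElem p := by
    apply LinearMap.ext
    intro X
    change p (p X) = p X
    rw [hpapp, hpapp, suProj_suProj]
  -- the decomposition `M = range p ⊕ ker p`
  set S := LinearMap.range p with hS
  set K := LinearMap.ker p with hK
  have hc : IsCompl S K := LinearMap.IsIdempotentElem.isCompl hidem
  set e := Submodule.prodEquivOfIsCompl S K hc with he
  -- the operator, as a linear map
  set T : Matrix (Fin n) (Fin n) ℂ →ₗ[ℝ] Matrix (Fin n) (Fin n) ℂ :=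
    (((P.comp (Lop.comp P) + (ContinuousLinearMap.id ℝ (Matrix (Fin n) (Fin n) ℂ) - P)) :
      Matrix (Fin n) (Fin n) ℂ →L[ℝ] Matrix (Fin n) (Fin n) ℂ) :
        Matrix (Fin n) (Fin n) ℂ →ₗ[ℝ] Matrix (Fin n) (Fin n) ℂ) with hT
  have hTapp : ∀ X, T X = suProj (Lop (suProj X)) + (X - suProj X) := fun X => by
    change P (Lop (P X)) + (X - P X) = _
    rw [hPapp, hPapp]
  -- its restriction to `S`
  have hmemS : ∀ X, suProj X ∈ S := fun X => ⟨X, hpapp X⟩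
  set TS : S →ₗ[ℝ] S := (p ∘ₗ (Lop : Matrix (Fin n) (Fin n) ℂ →ₗ[ℝ] Matrix (Fin n) (Fin n) ℂ) ∘ₗ S.subtype).codRestrict S
    (fun x => LinearMap.mem_range_self p _) with hTS
  have hTSapp : ∀ x : S, (TS x : Matrix (Fin n) (Fin n) ℂ) = suProj (Lop x) := fun x => by
    rw [hTS, LinearMap.codRestrict_apply]
    exact hpapp _
  -- `T ∘ e = e ∘ (TS × id)`
  have hPadd : ∀ A B : Matrix (Fin n) (Fin n) ℂ, suProj (A + B) = suProj A + suProj B := fun A B => by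
    rw [← hPapp, ← hPapp, ← hPapp, map_add]
  have hS_fix : ∀ x : S, suProj (x : Matrix (Fin n) (Fin n) ℂ) = x := fun x => by
    obtain ⟨y, hy⟩ := x.2
    rw [← hy, hpapp, suProj_suProj]
  have hK_zero : ∀ y : K, suProj (y : Matrix (Fin n) (Fin n) ℂ) = 0 := fun y => by
    have h : p (y : Matrix (Fin n) (Fin n) ℂ) = 0 := LinearMap.mem_ker.mp y.2
    rw [hpapp] at h
    exact h
  have hconj : ∀ z : S × K, T (e z) = e ((TS.prodMap LinearMap.id) z) := by
    rintro ⟨x, y⟩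
    rw [he, Submodule.coe_prodEquivOfIsCompl', Submodule.coe_prodEquivOfIsCompl', LinearMap.prodMap_apply,
      LinearMap.id_apply, hTapp, hPadd, hS_fix, hK_zero, add_zero]
    change suProj (Lop x) + ((x : Matrix (Fin n) (Fin n) ℂ) + y - x) = (TS x : Matrix (Fin n) (Fin n) ℂ) + y
    rw [hTSapp]
    abel
  have hTeq : T = (e : S × K →ₗ[ℝ] Matrix (Fin n) (Fin n) ℂ) ∘ₗ (TS.prodMap LinearMap.id) ∘ₗ
      (e.symm : Matrix (Fin n) (Fin n) ℂ →ₗ[ℝ] S × K) := by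
    apply LinearMap.ext
    intro m
    change T m = e ((TS.prodMap LinearMap.id) (e.symm m))
    rw [← hconj, LinearEquiv.apply_symm_apply]
  -- determinants
  have hdetT : LinearMap.det T = LinearMap.det TS := by
    rw [hTeq, LinearMap.det_conj, LinearMap.det_prodMap, LinearMap.det_id, mul_one]
  -- a basis of `S` from the `SuBasis`, with coordinates `coord`
  have hTmem : ∀ b, B.T b ∈ S := fun b => by
    obtain ⟨h1, h2⟩ := (mem_suAlgebra_iff _).1 (B.mem b)
    exact ⟨B.T b, by rw [hpapp, suProj_eq_self h1 h2]⟩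
  set v : B.ι → S := fun b => ⟨B.T b, hTmem b⟩ with hv
  have hli : LinearIndependent ℝ v := by
    rw [Fintype.linearIndependent_iff]
    intro g hg b
    have h0 : (∑ i, g i • v i : S) = 0 := hg
    have h1 : ∑ i, g i • B.T i = (0 : Matrix (Fin n) (Fin n) ℂ) := by
      have h2 := congrArg (Subtype.val : S → Matrix (Fin n) (Fin n) ℂ) h0
      simpa [Submodule.coe_sum, Submodule.coe_smul, hv] using h2
    have h3 := congrArg (B.coord b) h1
    rw [suBasis_coord_sum, suBasis_coord_zero] at h3
    simp_rw [suBasis_coord_smul, suBasis_coord_T] at h3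
    simpa using h3
  have hsp : ⊤ ≤ Submodule.span ℝ (Set.range v) := by
    rintro x -
    have hx : x = ∑ b, B.coord b (x : Matrix (Fin n) (Fin n) ℂ) • v b := by
      apply Subtype.ext
      rw [Submodule.coe_sum]
      simp only [Submodule.coe_smul, hv]
      conv_lhs => rw [← hS_fix x]
      exact suProj_eq_sum_coord_smul B _
    rw [hx]
    exact Submodule.sum_mem _ fun b _ => Submodule.smul_mem _ _ (Submodule.subset_span ⟨b, rfl⟩)
  set bS : Module.Basis B.ι ℝ S := Module.Basis.mk hli hsp with hbS
  have hbSv : ∀ b, bS b = v b := fun b => Module.Basis.mk_apply hli hsp b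
  have hrepr : ∀ (x : S) (i : B.ι), bS.repr x i = B.coord i (x : Matrix (Fin n) (Fin n) ℂ) := by
    intro x i
    have hx : x = ∑ b, B.coord b (x : Matrix (Fin n) (Fin n) ℂ) • bS b := by
      apply Subtype.ext
      rw [Submodule.coe_sum]
      simp only [Submodule.coe_smul, hbSv, hv]
      conv_lhs => rw [← hS_fix x]
      exact suProj_eq_sum_coord_smul B _
    conv_lhs => rw [hx]
    rw [bS.repr_sum_self]
  -- the matrix of `TS` in this basis is the booked matrix
  have hmat : LinearMap.toMatrix bS bS TS = Matrix.of fun b c : B.ι => B.coord b (Lop (B.T c)) := by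
    ext i j
    rw [LinearMap.toMatrix_apply, Matrix.of_apply, hrepr, hTSapp, suBasis_coord_suProj, hbSv]
  change LinearMap.det T = _
  rw [hdetT, ← LinearMap.det_toMatrix bS, hmat]

end Summit.Ventures.LatticeQCDFlow.Exactness

end
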